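import Summits.QuantumFields.YangMills.Theorems.PoincareLipschitzFlatRieszLogSup
import Literature.MathematicalPhysics.QuantumFieldTheory.Balaban1983to89.B4Green244
import HarnessLib

/-!
# Line «poincare_lipschitz» on crux `HistoryTailL` (stmt-QuantumFields-19936), route crux `BlockLipschitzL` (stmt-QuantumFields-23533), K2 organ M-COUL —
# «BLOCK-MASS step 2», FILE A: RIESZ-LOG-SUP IN ENERGY-FREE SOURCED FORM, and the GREEN-FREE LOCAL GRADIENT BOUND FOR THE BLOCK-MASS EQUATION
# `n²(−Δh) + m²h + a·Q*Qh = n·∂*f` (real `ℤ^d` letters): `n·|∇h(x)| ≤ C_d·(log₂(n+1)+1)·(‖f‖_∞ + (1+m²+a)·‖h‖_∞)` on ANY region, three blocks in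

Cell `ym3-torus` (YM ladder rung R3 = continuum SU(2) Yang–Mills on the three-torus — a RUNG, NOT the Clay problem: not d = 4, not infinite volume, not a
mass gap); width seat `ym3-torus-px7` gen 5 (LEAD ym-ust-19936-w1 g8 WORD 4, 2026-08-29T03:24:53Z: «BLOCK-MASS step 2 (sharp log n) — GO as located; (B)
GREEN-FREE local form + (C) headline over ★w5's solution; keep §1 generic»; ★w5-19936 g11's M-COUL-LOCATE §4 and parallel LOCATE 03:23:58Z).  THEOREMS ONLY
(def-free), in the `ℤ^d` letters of lit ✓`B4Eq19LatticeOperators` (`lop`, `dvg`, `fdiff`, `gradSq`, `box`) with the `n`-block of a site written with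
✓`B4Green244.finePt∕coarse`; `--supports stmt-QuantumFields-19936`.  FILE B (`PoincareLipschitzFlatBlockMassRieszLog`) carries the complex `opD` dictionary and
the headline `‖∂^ηG_k(0)∂^{η*}f‖_∞ ≤ C·(log₂(n+1)+1)·‖f‖_∞` over ★w5's solution.  Nothing here proves hLow, the per-bond charts, `hStab`, F6, a stub,
`BlockLipschitzL`, `HistoryTailL` or a summit statement.

WHY (card v1.34 (c); LEAD w1 g8 RULING «M-COUL-G skeleton = {step 1 ✓p692392, step 2, COV-GRAD-EXCESS, S-ALIGN, DEEPLOWCHART-MARGIN} + typed face»).  The block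
mass `a·Q*Q` caps the Riesz logarithm of ✓`PoincareLipschitzFlatRieszLog` at the BLOCK scale: the true `ℓ^∞ → ℓ^∞` norm of `∂G_k(0)∂*` is `≍ log n = k·log₂L`
(✓p692392 has the crude `n`).  The located route (px7 g5 ∕ ★w5 g11, 03:23Z): RIESZ-LOG-SUP ✓p691648 on ONE block around `x`, the mass-plus-averaging term
`(m²h + a·Q*Qh)∕n²` moved to the right side as a bounded zeroth-order source (divergence form by lit ✓`exists_antideriv`, cost `×(4N+9)`), the top-scale energy
discharged by lit ✓`caccioppoli` (`ρ = N`, `s = N+1`) against `sup|h|`.  This file is that local analysis, Green-function-free.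

* §1 `dvg_add`, `sum_sq_le_card_mul`, ★★ `exists_abs_fdiff_le_log_sourced` — RIESZ-LOG-SUP, ENERGY-FREE SOURCED FORM (generic `ℤ^d`; also the flat sup-half a
  covariant gradient-excess step may import): `lop 0 u = dvg g + V` on `Q_{2N+4}(x)`, `|g| ≤ m`, `|V| ≤ v` there, `|u| ≤ H` on `Q_{2N+6}(x)` ⟹
  `|∂_μu(x)| ≤ K_d·(log₂(N+1)+1)·(m + (N+1)·v + H∕(N+1))`.
* §2 `finePt_coarse_mem_box`, `abs_blockMean_le`, ★★ `exists_nfdiff_le_log_blockMass` — (B) GREEN-FREE, REAL letters: `n²·lop 0 h + m²·h + a·(n^{−d}Σ_{B(y)}h) =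
  n·dvg f` on `Q_{2n+4}(x)`, `|f| ≤ F` there, `|h| ≤ H` on `Q_{3n+6}(x)` ⟹ `n·|h(x+e_μ) − h(x)| ≤ C_d·(log₂(n+1)+1)·(F + (1 + m² + a)·H)`.
HONEST.  Flat (`A = 0`), scalar; the `log` is the Calderón–Zygmund logarithm below the block scale and is not removed here; nothing covariant ∕ multiscale; YM₃ on T³
is rung R3, not the Clay problem.  [folklore] ([Giaquinta1984] Ch. III §2 (2.4) p.77, §3 Thm 3.1 p.84; [Balaban1983RegularityDecay] (1.6) p.572, Lemma 2.2 (2.17)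
p.578, (2.44) p.584; [Balaban1984PropagatorsII] (1.9) p.226 — print loci of the flat lattice estimates).
-/

set_option autoImplicit false

noncomputable section

open scoped BigOperators
open Finset

namespace Summit.QuantumFields.YangMills.Theorems.PoincareLipschitzFlatRieszLogSourced

open Literature.MathematicalPhysics.QuantumFieldTheory.Balaban1983to89
open B4Eq19LatticeOperators B4Eq19LatticeBoxMeans
open B4Eq19LatticeCaccioppoli (caccioppoli)
open B4Eq19LatticeDirichletZero (exists_antideriv)
open B4Eq19LatticeGradientCampanato (sum_sq_fdiff_le_gradSq)
open Summit.QuantumFields.YangMills.Theorems.PoincareLipschitzFlatRieszLogSup (exists_abs_fdiff_le_log_of_dvg)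

/-! ## §1 The energy-free, sourced form of RIESZ-LOG-SUP on `ℤ^d` -/

section Flat

variable {d : ℕ}

/-- `dvg` is additive in the bond field. [folklore] -/
theorem dvg_add (g g' : Zd d → Fin d → ℝ) (y : Zd d) : dvg (fun z μ => g z μ + g' z μ) y = dvg g y + dvg g' y := by
  simp only [dvg_apply]
  rw [← Finset.sum_add_distrib]
  exact Finset.sum_congr rfl fun μ _ => by ring

/-- On a box of radius `r ≥ 0`, a function bounded by `H` has `Σ_{Q_r} u² ≤ (2r+1)^d·H²`. [folklore] -/
theorem sum_sq_le_card_mul (u : Zd d → ℝ) (z : Zd d) {r : ℤ} (hr : 0 ≤ r) {H : ℝ} (hu : ∀ y ∈ box z r, |u y| ≤ H) :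
    ∑ y ∈ box z r, u y ^ 2 ≤ ((2 * r + 1 : ℤ) : ℝ) ^ d * H ^ 2 := by
  calc ∑ y ∈ box z r, u y ^ 2 ≤ ∑ _y ∈ box z r, H ^ 2 := Finset.sum_le_sum fun y hy => by
          have := hu y hy
          rw [← sq_abs]
          exact pow_le_pow_left₀ (abs_nonneg _) this 2
    _ = ((2 * r + 1 : ℤ) : ℝ) ^ d * H ^ 2 := by rw [Finset.sum_const, nsmul_eq_mul, card_box z hr]

/-- ★★ **RIESZ-LOG-SUP, ENERGY-FREE SOURCED FORM**: `d ≥ 1`; there is `K = K_d > 0` such that for every `N ≥ 0`, every `u` with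
`−Δu = ∂*g + V` on `Q_{2N+4}(x)` (`lop 0 u = dvg g + V`), `|g| ≤ m` and `|V| ≤ v` on `Q_{2N+4}(x)` and `|u| ≤ H` on `Q_{2N+6}(x)`:
`|∂_μu(x)| ≤ K·(log₂(N+1)+1)·(m + (N+1)·v + H∕(N+1))` — the zeroth-order source is divergence-form data of density `(4N+9)v`
(✓`exists_antideriv`), the top-scale energy of ✓`exists_abs_fdiff_le_log_of_dvg` is discharged by Caccioppoli (✓`caccioppoli`, `ρ = N`, `s = N+1`)
against the sup of `u`. [folklore] [cite: Giaquinta1984, Ch. III §2 (2.4) p.77, §3 Thm 3.1 p.84; Balaban1984PropagatorsII, (1.9) p.226] -/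
theorem exists_abs_fdiff_le_log_sourced (hd : 1 ≤ d) : ∃ K : ℝ, 0 < K ∧
    ∀ (u : Zd d → ℝ) (g : Zd d → Fin d → ℝ) (V : Zd d → ℝ) (x : Zd d) (m v H : ℝ) (N : ℤ), 0 ≤ N → 0 ≤ m → 0 ≤ v → 0 ≤ H →
      (∀ y ∈ box x (2 * N + 4), lop 0 u y = dvg g y + V y) → (∀ y ∈ box x (2 * N + 4), ∀ ν, |g y ν| ≤ m) →
      (∀ y ∈ box x (2 * N + 4), |V y| ≤ v) → (∀ y ∈ box x (2 * N + 6), |u y| ≤ H) →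
      ∀ μ : Fin d, |fdiff μ u x| ≤ K * (((Nat.log 2 (N + 1).toNat : ℝ) + 1) * (m + ((N : ℝ) + 1) * v + H / ((N : ℝ) + 1))) := by
  obtain ⟨K, hK, hRL⟩ := exists_abs_fdiff_le_log_of_dvg hd
  have hd0 : 0 < d := hd
  have hdR : (1 : ℝ) ≤ d := by exact_mod_cast hd
  -- the constant
  set C : ℝ := 9 * (1 + 2 * (d : ℝ) * 5 ^ d) + 4 * (d : ℝ) * 7 ^ d with hC
  have hC1 : 1 ≤ C := by
    have : (0 : ℝ) ≤ 2 * (d : ℝ) * 5 ^ d := by positivity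
    have : (0 : ℝ) ≤ 4 * (d : ℝ) * 7 ^ d := by positivity
    rw [hC]; nlinarith
  refine ⟨K * C, by positivity, ?_⟩
  intro u g V x m v H N hN hm hv hH hEq hg hV hu μ
  have hNR : (0 : ℝ) ≤ N := by exact_mod_cast hN
  have hN1 : (0 : ℝ) < (N : ℝ) + 1 := by linarith
  -- §a the zeroth-order source in divergence form on `Q_{2N+4}(x)`
  obtain ⟨g₀, hg₀eq, hg₀b⟩ := exists_antideriv hd0 V x (2 * N + 4) hV
  set gt : Zd d → Fin d → ℝ := fun z ν => g z ν + g₀ z ν with hgt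
  set mt : ℝ := m + (2 * (2 * (N : ℝ) + 4) + 1) * v with hmt
  have hmt0 : 0 ≤ mt := by rw [hmt]; positivity
  have hEqt : ∀ y ∈ box x (2 * N + 4), lop 0 u y = dvg gt y := by
    intro y hy
    rw [hgt, dvg_add, hg₀eq y hy, hEq y hy]
  have hgt_b : ∀ y ∈ box x (2 * N + 4), ∀ ν, |gt y ν| ≤ mt := by
    intro y hy ν
    have h1 := hg y hy ν
    have h2 := hg₀b y hy ν
    have h2' : |g₀ y ν| ≤ (2 * (2 * (N : ℝ) + 4) + 1) * v := by
      have e : ((2 * ((2 * N + 4 : ℤ) : ℝ) + 1)) = 2 * (2 * (N : ℝ) + 4) + 1 := by push_cast; ring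
      rw [← e]; exact h2
    calc |gt y ν| = |g y ν + g₀ y ν| := rfl
      _ ≤ |g y ν| + |g₀ y ν| := abs_add_le _ _
      _ ≤ mt := by rw [hmt]; linarith only [h1, h2']
  -- §b Caccioppoli at `ρ = N`, `s = N + 1`: the top-scale energy against the sup of `u`
  have hCacc := caccioppoli (κ := 0) le_rfl u gt x hN (by linarith : (1 : ℤ) ≤ N + 1)
    (fun y hy => hEqt y (box_mono x (by linarith) hy))
  have e1 : (N + (N + 1) + 2 : ℤ) = 2 * N + 3 := by ring
  have e2 : (N + (N + 1) + 1 : ℤ) = 2 * N + 2 := by ring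
  rw [e1, e2] at hCacc
  have hsN : (((N + 1 : ℤ) : ℝ)) = (N : ℝ) + 1 := by push_cast; ring
  rw [hsN] at hCacc
  -- the two sums
  have hU : ∑ y ∈ box x (2 * N + 3), u y ^ 2 ≤ ((2 * (2 * N + 3) + 1 : ℤ) : ℝ) ^ d * H ^ 2 :=
    sum_sq_le_card_mul u x (by linarith) fun y hy => hu y (box_mono x (by linarith) hy)
  have hG : ∑ y ∈ box x (2 * N + 2), ∑ ν, gt y ν ^ 2 ≤ ((2 * (2 * N + 2) + 1 : ℤ) : ℝ) ^ d * ((d : ℝ) * mt ^ 2) := by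
    have hpt : ∀ y ∈ box x (2 * N + 2), ∑ ν, gt y ν ^ 2 ≤ (d : ℝ) * mt ^ 2 := by
      intro y hy
      calc ∑ ν, gt y ν ^ 2 ≤ ∑ _ν : Fin d, mt ^ 2 := Finset.sum_le_sum fun ν _ => by
              rw [← sq_abs]; exact pow_le_pow_left₀ (abs_nonneg _) (hgt_b y (box_mono x (by linarith) hy) ν) 2
        _ = (d : ℝ) * mt ^ 2 := by rw [Finset.sum_const, Finset.card_univ, Fintype.card_fin, nsmul_eq_mul]
    calc ∑ y ∈ box x (2 * N + 2), ∑ ν, gt y ν ^ 2 ≤ ∑ _y ∈ box x (2 * N + 2), (d : ℝ) * mt ^ 2 := Finset.sum_le_sum hpt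
      _ = ((2 * (2 * N + 2) + 1 : ℤ) : ℝ) ^ d * ((d : ℝ) * mt ^ 2) := by
          rw [Finset.sum_const, nsmul_eq_mul, card_box x (by linarith)]
  -- box cardinalities against `(N+1)^d`
  have hc1 : ((2 * (2 * N + 3) + 1 : ℤ) : ℝ) ^ d ≤ (7 : ℝ) ^ d * ((N : ℝ) + 1) ^ d := by
    rw [← mul_pow]; apply pow_le_pow_left₀ (by push_cast; linarith); push_cast; linarith
  have hc2 : ((2 * (2 * N + 2) + 1 : ℤ) : ℝ) ^ d ≤ (5 : ℝ) ^ d * ((N : ℝ) + 1) ^ d := by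
    rw [← mul_pow]; apply pow_le_pow_left₀ (by push_cast; linarith); push_cast; linarith
  -- the energy bound `E ≤ (A + B)²·(N+1)^d`, `A = 4d·7^d·H/(N+1)`, `B = 2d·5^d·mt`
  set A : ℝ := 4 * (d : ℝ) * 7 ^ d * (H / ((N : ℝ) + 1)) with hA
  set B : ℝ := 2 * (d : ℝ) * 5 ^ d * mt with hB
  have hA0 : 0 ≤ A := by positivity
  have hB0 : 0 ≤ B := by positivity
  have hNd : (0 : ℝ) < ((N : ℝ) + 1) ^ d := by positivity
  have hE : ∑ y ∈ box x N, fdiff μ u y ^ 2 ≤ (A + B) ^ 2 * ((N : ℝ) + 1) ^ d := by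
    have h1 : ∑ y ∈ box x N, fdiff μ u y ^ 2 ≤ gradSq u (box x N) := sum_sq_fdiff_le_gradSq u _ μ
    have hU' : ∑ y ∈ box x (2 * N + 3), u y ^ 2 ≤ (7 : ℝ) ^ d * ((N : ℝ) + 1) ^ d * H ^ 2 :=
      hU.trans (mul_le_mul_of_nonneg_right hc1 (sq_nonneg H))
    have hG' : ∑ y ∈ box x (2 * N + 2), ∑ ν, gt y ν ^ 2 ≤ (5 : ℝ) ^ d * ((N : ℝ) + 1) ^ d * ((d : ℝ) * mt ^ 2) :=
      hG.trans (mul_le_mul_of_nonneg_right hc2 (by positivity))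
    have hc14 : (0 : ℝ) ≤ 14 * d / ((N : ℝ) + 1) ^ 2 := by positivity
    have t1 := mul_le_mul_of_nonneg_left hU' hc14
    have t2 := mul_le_mul_of_nonneg_left hG' (by norm_num : (0 : ℝ) ≤ 4)
    have h2 : gradSq u (box x N) ≤ 14 * d / ((N : ℝ) + 1) ^ 2 * ((7 : ℝ) ^ d * ((N : ℝ) + 1) ^ d * H ^ 2) +
        4 * ((5 : ℝ) ^ d * ((N : ℝ) + 1) ^ d * ((d : ℝ) * mt ^ 2)) := hCacc.trans (add_le_add t1 t2)
    -- `14d·7^d·H²/(N+1)² ≤ A²` and `4·5^d·d·mt² ≤ B²`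
    have h3 : 14 * d / ((N : ℝ) + 1) ^ 2 * ((7 : ℝ) ^ d * ((N : ℝ) + 1) ^ d * H ^ 2) ≤ A ^ 2 * ((N : ℝ) + 1) ^ d := by
      have e : 14 * d / ((N : ℝ) + 1) ^ 2 * ((7 : ℝ) ^ d * ((N : ℝ) + 1) ^ d * H ^ 2) =
          (14 * (d : ℝ) * 7 ^ d) * (H / ((N : ℝ) + 1)) ^ 2 * ((N : ℝ) + 1) ^ d := by
        field_simp
      rw [e, hA]
      apply mul_le_mul_of_nonneg_right _ hNd.le
      rw [mul_pow, show (4 * (d : ℝ) * 7 ^ d) ^ 2 = 16 * (d : ℝ) ^ 2 * (7 ^ d) ^ 2 by ring]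
      apply mul_le_mul_of_nonneg_right _ (sq_nonneg _)
      have h7 : (7 : ℝ) ^ d ≤ (7 ^ d) ^ 2 := by
        rw [sq]; exact le_mul_of_one_le_right (by positivity) (one_le_pow₀ (by norm_num))
      have hdd : (d : ℝ) ≤ (d : ℝ) ^ 2 := by rw [sq]; exact le_mul_of_one_le_right (by positivity) hdR
      have hp : (d : ℝ) * 7 ^ d ≤ (d : ℝ) ^ 2 * (7 ^ d) ^ 2 := mul_le_mul hdd h7 (by positivity) (by positivity)
      linarith only [hp, (by positivity : (0 : ℝ) ≤ (d : ℝ) * 7 ^ d)]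
    have h4 : 4 * ((5 : ℝ) ^ d * ((N : ℝ) + 1) ^ d * ((d : ℝ) * mt ^ 2)) ≤ B ^ 2 * ((N : ℝ) + 1) ^ d := by
      have e : 4 * ((5 : ℝ) ^ d * ((N : ℝ) + 1) ^ d * ((d : ℝ) * mt ^ 2)) = (4 * (d : ℝ) * 5 ^ d) * mt ^ 2 * ((N : ℝ) + 1) ^ d := by
        ring
      rw [e, hB]
      apply mul_le_mul_of_nonneg_right _ hNd.le
      rw [mul_pow, show (2 * (d : ℝ) * 5 ^ d) ^ 2 = 4 * (d : ℝ) ^ 2 * (5 ^ d) ^ 2 by ring]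
      apply mul_le_mul_of_nonneg_right _ (sq_nonneg _)
      have h5 : (5 : ℝ) ^ d ≤ (5 ^ d) ^ 2 := by
        rw [sq]; exact le_mul_of_one_le_right (by positivity) (one_le_pow₀ (by norm_num))
      have hdd : (d : ℝ) ≤ (d : ℝ) ^ 2 := by rw [sq]; exact le_mul_of_one_le_right (by positivity) hdR
      have hp : (d : ℝ) * 5 ^ d ≤ (d : ℝ) ^ 2 * (5 ^ d) ^ 2 := mul_le_mul hdd h5 (by positivity) (by positivity)
      linarith only [hp]
    have h5 : A ^ 2 * ((N : ℝ) + 1) ^ d + B ^ 2 * ((N : ℝ) + 1) ^ d ≤ (A + B) ^ 2 * ((N : ℝ) + 1) ^ d := by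
      rw [← add_mul]
      refine mul_le_mul_of_nonneg_right ?_ hNd.le
      rw [add_sq]; linarith only [mul_nonneg hA0 hB0]
    linarith only [h1, h2, h3, h4, h5]
  -- §c RIESZ-LOG-SUP with `E := (A + B)²·(N+1)^d`
  have hmain := hRL u gt x mt N hN (fun y hy => hEqt y (box_mono x (by linarith) hy))
    (fun y hy ν => hgt_b y (box_mono x (by linarith) hy) ν) μ ((A + B) ^ 2 * ((N : ℝ) + 1) ^ d) hE
  have hsq : Real.sqrt ((A + B) ^ 2 * ((N : ℝ) + 1) ^ d / ((N : ℝ) + 1) ^ d) = A + B := by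
    rw [mul_div_cancel_right₀ _ hNd.ne', Real.sqrt_sq (add_nonneg hA0 hB0)]
  rw [hsq] at hmain
  -- §d bookkeeping: `mt + A + B ≤ C·(m + (N+1)v + H/(N+1))`
  have hlog0 : (0 : ℝ) ≤ (Nat.log 2 (N + 1).toNat : ℝ) + 1 := by positivity
  set S : ℝ := m + ((N : ℝ) + 1) * v with hS
  set Q : ℝ := H / ((N : ℝ) + 1) with hQ
  have hS0 : 0 ≤ S := by positivity
  have hQ0 : 0 ≤ Q := by positivity
  have hmt_le : mt ≤ 9 * S := by
    rw [hmt, hS]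
    have h0 : 0 ≤ (N : ℝ) * v := mul_nonneg hNR hv
    have e : 9 * (m + ((N : ℝ) + 1) * v) - (m + (2 * (2 * (N : ℝ) + 4) + 1) * v) = 8 * m + 5 * ((N : ℝ) * v) := by ring
    linarith only [h0, e, hm]
  have hD5 : (0 : ℝ) ≤ 2 * (d : ℝ) * 5 ^ d := by positivity
  have hD7 : (0 : ℝ) ≤ 4 * (d : ℝ) * 7 ^ d := by positivity
  have hB_le : B ≤ 2 * (d : ℝ) * 5 ^ d * (9 * S) := by rw [hB]; exact mul_le_mul_of_nonneg_left hmt_le hD5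
  have hA_eq : A = 4 * (d : ℝ) * 7 ^ d * Q := by rw [hA]
  have hkey : mt + (A + B) ≤ C * (S + Q) := by
    have e : C * (S + Q) = (9 * (1 + 2 * (d : ℝ) * 5 ^ d)) * S + (4 * (d : ℝ) * 7 ^ d) * Q +
        ((9 * (1 + 2 * (d : ℝ) * 5 ^ d)) * Q + (4 * (d : ℝ) * 7 ^ d) * S) := by rw [hC]; ring
    rw [e, hA_eq]
    have hx1 : 0 ≤ (9 * (1 + 2 * (d : ℝ) * 5 ^ d)) * Q := by positivity
    have hx2 : 0 ≤ (4 * (d : ℝ) * 7 ^ d) * S := by positivity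
    linarith only [hmt_le, hB_le, hx1, hx2]
  calc |fdiff μ u x| ≤ K * (((Nat.log 2 (N + 1).toNat : ℝ) + 1) * (mt + (A + B))) := hmain
    _ ≤ K * (((Nat.log 2 (N + 1).toNat : ℝ) + 1) * (C * (S + Q))) :=
        mul_le_mul_of_nonneg_left (mul_le_mul_of_nonneg_left hkey hlog0) hK.le
    _ = K * C * (((Nat.log 2 (N + 1).toNat : ℝ) + 1) * (S + Q)) := by ring

end Flat

/-! ## §2 (B) The GREEN-FREE local theorem: the gradient of a solution of the block-mass equation, REAL letters -/

section LocalReal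

variable {d : ℕ}

open B4Green244 (coarse finePt)

/-- Every point of the `n`-block of `y` lies in `Q_{n−1}(y)` (`n ≥ 1`): `|n⌊y_ν∕n⌋ + j_ν − y_ν| ≤ n − 1` for `0 ≤ j_ν < n`. [folklore] -/
theorem finePt_coarse_mem_box {n : ℕ} (hn : 1 ≤ n) (y : Zd d) (j : Fin d → Fin n) : finePt n (coarse n y) j ∈ box y ((n : ℤ) - 1) := by
  rw [mem_box]
  intro i
  simp only [finePt, coarse]
  have hn0 : (0 : ℤ) < n := by exact_mod_cast hn
  have h1 := Int.mul_ediv_add_emod (y i) (n : ℤ)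
  have h2 := Int.emod_nonneg (y i) hn0.ne'
  have h3 := Int.emod_lt_of_pos (y i) hn0
  have h4 : ((j i : ℕ) : ℤ) < n := by exact_mod_cast (j i).isLt
  have h5 : (0 : ℤ) ≤ ((j i : ℕ) : ℤ) := by positivity
  rw [abs_le]
  constructor <;> linarith

/-- The block mean of a function bounded by `H` on `Q_{n−1}(y)` is bounded by `H`. [folklore] -/
theorem abs_blockMean_le {n : ℕ} (hn : 1 ≤ n) (h : Zd d → ℝ) (y : Zd d) {H : ℝ} (hH : ∀ z ∈ box y ((n : ℤ) - 1), |h z| ≤ H) :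
    |((n : ℝ) ^ d)⁻¹ * ∑ j : Fin d → Fin n, h (finePt n (coarse n y) j)| ≤ H := by
  have hnd : (0 : ℝ) < (n : ℝ) ^ d := by positivity
  have hcard : (Fintype.card (Fin d → Fin n) : ℝ) = (n : ℝ) ^ d := by
    rw [Fintype.card_fun, Fintype.card_fin, Fintype.card_fin]; push_cast; ring
  rw [abs_mul, abs_inv, abs_of_pos hnd]
  have hs : |∑ j : Fin d → Fin n, h (finePt n (coarse n y) j)| ≤ (n : ℝ) ^ d * H := by
    calc |∑ j : Fin d → Fin n, h (finePt n (coarse n y) j)| ≤ ∑ j : Fin d → Fin n, |h (finePt n (coarse n y) j)| :=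
          Finset.abs_sum_le_sum_abs _ _
      _ ≤ ∑ _j : Fin d → Fin n, H := Finset.sum_le_sum fun j _ => hH _ (finePt_coarse_mem_box hn y j)
      _ = (n : ℝ) ^ d * H := by rw [Finset.sum_const, Finset.card_univ, nsmul_eq_mul, hcard]
  calc ((n : ℝ) ^ d)⁻¹ * |∑ j : Fin d → Fin n, h (finePt n (coarse n y) j)| ≤ ((n : ℝ) ^ d)⁻¹ * ((n : ℝ) ^ d * H) :=
        mul_le_mul_of_nonneg_left hs (inv_nonneg.2 hnd.le)
    _ = H := by field_simp

/-- ★★ **(B) THE GREEN-FREE LOCAL FORM, REAL LETTERS**: `d ≥ 1`; there is `C = C_d > 0` such that for every block side `n ≥ 1`,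
coefficients `a, m² ≥ 0`, every real `h`, real bond data `f` and site `x` with
`n²·(−Δh)(y) + m²·h(y) + a·(n^{−d}Σ_{z ∈ B(y)} h(z)) = n·(∂*f)(y)` for `y ∈ Q_{2n+4}(x)` (the block-mass equation `(−Δ^η + m² + aQ*Q)h = ∂^{η*}f`
in lattice letters: `lop 0`, `dvg`, `B(y)` = the `n`-block of `y` written with `B4Green244.finePt∕coarse`), `|f| ≤ F` on `Q_{2n+4}(x)` and `|h| ≤ H`
on `Q_{3n+6}(x)`:  `n·|h(x+e_μ) − h(x)| ≤ C·(log₂(n+1)+1)·(F + (1 + m² + a)·H)`.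
Route: §1 at `N := n` with divergence data `f∕n` (density `F∕n`) and zeroth-order source `−(m²h + a·Bh)∕n²` (density `(m²+a)H∕n²`); ×`n`.
NO Green's function, NO box∕torus: any region, three blocks in from where the hypotheses hold.
[folklore] [cite: Balaban1983RegularityDecay, (1.6) p.572, Lemma 2.2 (2.17) p.578; Giaquinta1984, Ch. III §3 Thm 3.1 p.84] -/
theorem exists_nfdiff_le_log_blockMass (hd : 1 ≤ d) : ∃ C : ℝ, 0 < C ∧
    ∀ (n : ℕ) (a m2 : ℝ) (h : Zd d → ℝ) (f : Zd d → Fin d → ℝ) (x : Zd d) (F H : ℝ),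
      1 ≤ n → 0 ≤ a → 0 ≤ m2 → 0 ≤ F → 0 ≤ H →
      (∀ y ∈ box x (2 * (n : ℤ) + 4),
        (n : ℝ) ^ 2 * lop 0 h y + m2 * h y + a * (((n : ℝ) ^ d)⁻¹ * ∑ j : Fin d → Fin n, h (finePt n (coarse n y) j)) =
          (n : ℝ) * dvg f y) →
      (∀ y ∈ box x (2 * (n : ℤ) + 4), ∀ ν, |f y ν| ≤ F) → (∀ y ∈ box x (3 * (n : ℤ) + 6), |h y| ≤ H) →
      ∀ μ : Fin d, (n : ℝ) * |fdiff μ h x| ≤ C * (((Nat.log 2 (n + 1) : ℝ) + 1) * (F + (1 + m2 + a) * H)) := by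
  obtain ⟨K, hK, h1⟩ := exists_abs_fdiff_le_log_sourced hd
  refine ⟨2 * K, by positivity, ?_⟩
  intro n a m2 h f x F H hn ha hm2 hF hH hEq hf hh μ
  have hnR : (1 : ℝ) ≤ n := by exact_mod_cast hn
  have hn0 : (0 : ℝ) < n := by linarith
  have hnZ : (0 : ℤ) ≤ (n : ℤ) := by positivity
  -- the data of §1
  set g : Zd d → Fin d → ℝ := fun z ν => (n : ℝ)⁻¹ * f z ν with hg
  set V : Zd d → ℝ := fun y => -(m2 * h y + a * (((n : ℝ) ^ d)⁻¹ * ∑ j : Fin d → Fin n, h (finePt n (coarse n y) j))) / (n : ℝ) ^ 2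
    with hV
  have hn2 : (0 : ℝ) < (n : ℝ) ^ 2 := by positivity
  have hEq' : ∀ y ∈ box x (2 * (n : ℤ) + 4), lop 0 h y = dvg g y + V y := by
    intro y hy
    have e := hEq y hy
    rw [hg, dvg_const_mul, hV]
    have e' : lop 0 h y = ((n : ℝ) * dvg f y - (m2 * h y + a * (((n : ℝ) ^ d)⁻¹ * ∑ j : Fin d → Fin n, h (finePt n (coarse n y) j)))) /
        (n : ℝ) ^ 2 := by
      rw [eq_div_iff hn2.ne']; linarith only [e]
    rw [e']
    field_simp
    ring
  have hg' : ∀ y ∈ box x (2 * (n : ℤ) + 4), ∀ ν, |g y ν| ≤ F / n := by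
    intro y hy ν
    rw [hg]
    dsimp only
    rw [abs_mul, abs_inv, abs_of_pos hn0, div_eq_inv_mul]
    exact mul_le_mul_of_nonneg_left (hf y hy ν) (inv_nonneg.2 hn0.le)
  have hV' : ∀ y ∈ box x (2 * (n : ℤ) + 4), |V y| ≤ (m2 + a) * H / (n : ℝ) ^ 2 := by
    intro y hy
    have hB : |((n : ℝ) ^ d)⁻¹ * ∑ j : Fin d → Fin n, h (finePt n (coarse n y) j)| ≤ H :=
      abs_blockMean_le hn h y fun z hz => hh z (by
        refine box_subset_box (fun i => ?_) hz
        have := (mem_box.1 hy) i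
        linarith)
    have hhy : |h y| ≤ H := hh y (box_mono x (by linarith) hy)
    rw [hV, abs_div, abs_neg, abs_of_pos (by positivity : (0 : ℝ) < (n : ℝ) ^ 2)]
    apply div_le_div_of_nonneg_right _ (by positivity)
    calc |m2 * h y + a * (((n : ℝ) ^ d)⁻¹ * ∑ j : Fin d → Fin n, h (finePt n (coarse n y) j))|
        ≤ |m2 * h y| + |a * (((n : ℝ) ^ d)⁻¹ * ∑ j : Fin d → Fin n, h (finePt n (coarse n y) j))| := abs_add_le _ _
      _ = m2 * |h y| + a * |((n : ℝ) ^ d)⁻¹ * ∑ j : Fin d → Fin n, h (finePt n (coarse n y) j)| := by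
          rw [abs_mul, abs_mul, abs_of_nonneg hm2, abs_of_nonneg ha]
      _ ≤ m2 * H + a * H := add_le_add (mul_le_mul_of_nonneg_left hhy hm2) (mul_le_mul_of_nonneg_left hB ha)
      _ = (m2 + a) * H := by ring
  have hh' : ∀ y ∈ box x (2 * (n : ℤ) + 6), |h y| ≤ H := fun y hy => hh y (box_mono x (by linarith) hy)
  -- §1 at `N := n`
  have hmain := h1 h g V x (F / n) ((m2 + a) * H / (n : ℝ) ^ 2) H (n : ℤ) hnZ (by positivity) (by positivity) hH
    hEq' hg' hV' hh' μ
  have hcast : ((n : ℤ) : ℝ) = (n : ℝ) := by norm_cast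
  have htoNat : ((n : ℤ) + 1).toNat = n + 1 := by
    have : ((n : ℤ) + 1) = ((n + 1 : ℕ) : ℤ) := by push_cast; ring
    rw [this, Int.toNat_natCast]
  rw [hcast, htoNat] at hmain
  -- × `n`
  have hlog0 : (0 : ℝ) ≤ (Nat.log 2 (n + 1) : ℝ) + 1 := by positivity
  set Lg : ℝ := (Nat.log 2 (n + 1) : ℝ) + 1 with hLg
  have hmaH : 0 ≤ (m2 + a) * H := by positivity
  have hin : (n : ℝ) * (F / n + ((n : ℝ) + 1) * ((m2 + a) * H / (n : ℝ) ^ 2) + H / ((n : ℝ) + 1)) ≤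
      2 * (F + (1 + m2 + a) * H) := by
    have e1 : (n : ℝ) * (F / n) = F := by field_simp
    have e2 : (n : ℝ) * (((n : ℝ) + 1) * ((m2 + a) * H / (n : ℝ) ^ 2)) = (((n : ℝ) + 1) / n) * ((m2 + a) * H) := by
      field_simp
    have e3 : (n : ℝ) * (H / ((n : ℝ) + 1)) = ((n : ℝ) / ((n : ℝ) + 1)) * H := by ring
    have r1 : ((n : ℝ) + 1) / n ≤ 2 := by rw [div_le_iff₀ hn0]; linarith
    have r2 : (n : ℝ) / ((n : ℝ) + 1) ≤ 1 := by rw [div_le_one (by linarith)]; linarith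
    rw [mul_add, mul_add, e1, e2, e3]
    have t1 := mul_le_mul_of_nonneg_right r1 hmaH
    have t2 := mul_le_mul_of_nonneg_right r2 hH
    linarith only [t1, t2, hF, hH, hmaH]
  calc (n : ℝ) * |fdiff μ h x| ≤ (n : ℝ) * (K * (Lg * (F / n + ((n : ℝ) + 1) * ((m2 + a) * H / (n : ℝ) ^ 2) + H / ((n : ℝ) + 1)))) :=
        mul_le_mul_of_nonneg_left hmain hn0.le
    _ = K * (Lg * ((n : ℝ) * (F / n + ((n : ℝ) + 1) * ((m2 + a) * H / (n : ℝ) ^ 2) + H / ((n : ℝ) + 1)))) := by ring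
    _ ≤ K * (Lg * (2 * (F + (1 + m2 + a) * H))) :=
        mul_le_mul_of_nonneg_left (mul_le_mul_of_nonneg_left hin hlog0) hK.le
    _ = 2 * K * (Lg * (F + (1 + m2 + a) * H)) := by ring

end LocalReal

end Summit.QuantumFields.YangMills.Theorems.PoincareLipschitzFlatRieszLogSourced

end
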